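import Summits.ABC.IUTFork.Conditional.AbcOfCor312Slack
import Summits.ABC.IUTFork.Conditional.AbcOfSOrNumKContent
import HarnessLib

/-!
# The Σ-VARIANT CORE, RECUT (rh-lead RULING R14, 2026-08-26T23:54:09Z): the weakened Corollary with a tolerated slack ⟹ `abc`
# with the CONE binder CUT — `hreg ↦ hregBad` (Szpiro-bad locus, p452637 VERBATIM) and the still weaker θ-cut `hreg ↦ hregC` (content locus)

PROOF-ONLY sequel (no `def`, no new `Prop`, no instance, no notation; nothing re-typed) of this seat's `Conditional/AbcOfCor312Slack.lean`
(abc-iut-rh2-q2-cond gen 0, p469667) by abc-iut-rh2-q2-cond gen 2. TAKES NO SIDE on [IUTchIII] Cor. 3.12 or on any author.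

WHY. Every abc-end of p469667 (`ABC_of_cor312Slack_of_hullRegime` and its `Thm110Legendre` / `ThetaPartII` halves) carries the BLANKET cone
binder `hreg` («at EVERY admissible `(P, l)` and every genuine datum `T` off the slot-constant regime, `T.HullEstimateOf (B_III(P,l))`»), and that
binder is KERNEL-REFUTED as typed (abc-iut-s2-p5's `Conditional.not_hreg_v4`, p453135: the QuadWitness family). Hence those theorems are
COMPOSITION RECORDS, VACUOUS AS TYPED in [CONE] (rh-ref-3's binding caveat 2026-08-26T22:55:30Z; R14 (1)). R14 (2): the no-loss ARITHMETIC of the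
core file (§1 the slack squeeze `logQAvoid_le_of_cor312Slack`, §2 `display_of_squeezeIII_slack` / `…_slack'`) does not depend on which cone binder
supplies the hull estimate and is REUSED BY NAME below. R14 (3): recut on `hregBad` VERBATIM from abc-iut-C-cert-2's `Conditional.abc_of_SH_orNum_K_szpiroBad_hregBad`
(p452637) — the blanket binder with EXACTLY ONE added antecedent, the Szpiro-bad disjunction of abc-iut-c312-d1's `Cor22.forall_cor312Of_of_szpiroBad`
«`(l+5)/4 < d_mod ∨ (6l(l+5−4d_mod)/((l+4)(l−3)))·(log-diff + (1−1/l)·log-cond) + (6l(l+5)/((l+4)(l−3)))·log π < log q^{∤{2,l}}(λ)`».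

WHAT IS TYPED (notation of the core file: `Tol(P,l) = ((l+1)/4)·5·d*·l`, `d* = 2^{12}·3^3·5·d_mod`, `B_III(P,l)` print's Step (v) constant):
* §1 `hullEstimateOf_BIII_of_offRegime` — at ONE genuine datum `T` of an admissible `(P, l)`: the hull estimate with `B_III` GIVEN it off the
  slot-constant regime (on the regime it is abc-iut-S3's PINNED junction `PointDict.hullEstimateOf_BIII_pinned` over abc-iut-S1's (R4)
  `ThetaPartII.stub_R4` — a theorem, nothing assumed);
* §2 THE θ-CUT (content locus of [IUTchIV] Thm. 1.10's display, abc-iut-C-cert-1's `display_of_not_content` / `szpiroBad_of_content`, p460293's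
  parent): `thm110Legendre_of_cor312Slack_content_hregC`, **`ABC_of_cor312Slack_content_hregC`** — [NUMΣ-C] the weakened number-level Corollary
  `T.negAbsLogQ ≤ T.negLogTheta + ε P l T` demanded ONLY at admissible `(P, l)` with
  `6·(1 + 20·d_mod/l)·(log-diff + log-cond) + 120·d*_mod·l < log q^{∤{2,l}}(λ)` · [TOL-C] `ε P l T ≤ Tol(P,l)` there · [CONE-C] `hregC` VERBATIM
  from abc-iut-C-cert-1's `ABC_of_cor312C_of_hullRegimeC` ⟹ `Cor22.Thm110Legendre` with print's constants ⟹ `ABC`. Off the content locus the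
  display holds by its own additive constant, so NOTHING of any class is assumed at any admissible `(P, l)` with `log q^{∤{2,l}}(λ) ≤ 120·d*_mod·l`;
* §3 THE R14 RECUT: **`ABC_of_cor312Slack_szpiroBad_hregBad`** — [NUMΣ-bad] · [TOL-bad] · [CONE-bad] = the three binders of p469667 each with the
  Szpiro-bad antecedent of p452637 inserted at the same place (after (P6), before `∀ T`), `hregBad` = p452637 :`hregBad` VERBATIM; a λ-term over §2
  (`szpiroBad_of_content`: the content guard implies the Szpiro-bad guard, so content-cut binders are WEAKER-OR-EQUAL); and
  `ABC_of_cor312Slack_hregBad` — p469667's `ABC_of_cor312Slack_of_hullRegime` with `h312ε` / `hTol` AS THEY WERE and ONLY `hreg ↦ hregBad`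
  (guard-only delta: the minimal recut). Binder by binder every theorem here is STRONGER-OR-EQUAL than p469667's (`hreg ⟹ hregBad ⟹ hregC` by
  premise drop, `ThetaPartII.hullRegimeBad_of_hullRegime`).

READING (numbers unchanged, R14 (2)/(5)): the tolerance of the chain of record for an off-Σ remainder stays `Tol = 691200·d_mod·l(l+1)` in the
currency of `−|log(Θ)|` (`Tol♯`, budget `K`, ρ-window: sequel recut files); what moves is the kernel object carrying the sentence — the CONE factor
is now asked only at Szpiro-bad (resp. content-locus) admissible points, where `hregBad` / `hregC` are neither instantiated nor refuted as typed
(`not_hreg_v4` does not elaborate against the guarded text: its family is Szpiro-undecided in the tree). HONEST FRAMING: locates / conditionally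
verifies; nothing here asserts that abc is proved or refuted, or that [IUTchIII] Cor. 3.12 / Thm. 3.11 or [IUTchIV] Thm. 1.10 holds or fails at any
datum, or takes a side on any author (Mochizuki / Scholze–Stix / Joshi / Dupuy–Hilado); `h312…` / `hTol…` / `hregBad` / `hregC` are ASSUMPTION
LABELS, never asserted; «`ABC` follows from these hypotheses AS TYPED», nothing more; typed ≠ proved; instantiated ≠ endorsed; refuted-as-typed ≠
refuted-in-print. [cite: Mochizuki2012, IUTchIV Thm. 1.10 pp. 22–31 (Step (v) pp. 27–28, Step (viii) pp. 30–31); Cor. 2.2 (ii) pp. 41–48 (p. 46)]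
[cite: Mochizuki2012, IUTchIII Cor. 3.12 p. 174] [claim: Mochizuki2012, status: disputed]
-/

noncomputable section

namespace Summit.ABC.IUTFork.Conditional.Cor312Slack

open Literature.IUT.LogVolume Literature.IUT.HodgeTheaters Literature.NumberTheory.DiophantineGeometry.GenEll
open Summit.ABC.ABC.Theorems NumberField IsDedekindDomain

variable {P : NFPoint} {l : ℕ}

/-! ## §1 The hull estimate at one datum, given it off the slot-constant regime -/

/-- **The hull estimate with `B_III(P,l)` at ONE genuine datum `T` of an admissible `(P, l)`, GIVEN it off the slot-constant regime**: on the
regime (all local `log q` contributions over each support prime equal) it is abc-iut-S3's pinned junction `PointDict.hullEstimateOf_BIII_pinned`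
with (R4) supplied by abc-iut-S1's `ThetaPartII.stub_R4` and `l ≥ 7` by (P6) (`ThetaPartII.seven_le_of_condP6`) — a theorem; off it, the
hypothesis `hregT` (the per-datum instance of `hregBad` / `hregC`). Nothing asserted about `hregT`.
[cite: Mochizuki2012, IUTchIV Thm. 1.10 proof Steps (ii)–(v) pp. 24–29] [claim: Mochizuki2012, status: disputed] -/
theorem hullEstimateOf_BIII_of_offRegime (hP : P ∈ UP) (hl : l.Prime) (h5 : 5 ≤ l) (hcore : Cor22.AdmitsCore P)
    (hP2 : Cor22.CondP2 P l) (hP5 : Cor22.CondP5 P l) (h6 : Cor22.CondP6 P l) (T : Cor22.ThetaVolumeDatumAt P l)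
    (hregT :
        (letI := T.instFieldF; letI := T.instNumberFieldF; letI := T.instAlgebraF; letI := T.instFieldK
         letI := T.instNumberFieldK; letI := T.instAlgebraK; letI := T.instFieldFbar; letI := T.instAlgebraFbar
         letI := T.instAlgebraKFbar; letI := T.instIsElliptic
         ¬ (∀ p ∈ T.I.supportPrimes, ∀ v w : placesOver (fieldOfModuli T.E) p,
            (Summit.ABC.IUTFork.DHData.ofInput T.I).logQloc p v = (Summit.ABC.IUTFork.DHData.ofInput T.I).logQloc p w)) →
        T.HullEstimateOf
          (((l : ℝ) + 1) / 4 *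
            ((1 + 12 * (Cor22.dmod P : ℝ) / l) * (P.logDiff + Cor22.logCondAvoid P {2, l})
              + 2 * Real.log l + 52
              + 20 / 3 * Real.log (((2 ^ 12 * 3 ^ 3 * 5 * Cor22.dmod P : ℕ) : ℝ) * (l : ℝ))
                * (Nat.primeCounting (2 ^ 12 * 3 ^ 3 * 5 * Cor22.dmod P * l) : ℝ)))) :
    T.HullEstimateOf
      (((l : ℝ) + 1) / 4 *
        ((1 + 12 * (Cor22.dmod P : ℝ) / l) * (P.logDiff + Cor22.logCondAvoid P {2, l})
          + 2 * Real.log l + 52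
          + 20 / 3 * Real.log (((2 ^ 12 * 3 ^ 3 * 5 * Cor22.dmod P : ℕ) : ℝ) * (l : ℝ))
            * (Nat.primeCounting (2 ^ 12 * 3 ^ 3 * 5 * Cor22.dmod P * l) : ℝ))) := by
  letI := T.instFieldF; letI := T.instNumberFieldF; letI := T.instAlgebraF; letI := T.instFieldK
  letI := T.instNumberFieldK; letI := T.instAlgebraK; letI := T.instFieldFbar; letI := T.instAlgebraFbar
  letI := T.instAlgebraKFbar; letI := T.instIsElliptic
  have h7 : 7 ≤ l := ThetaPartII.seven_le_of_condP6 hP hl h5 h6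
  by_cases hcst : ∀ p ∈ T.I.supportPrimes, ∀ v w : placesOver (fieldOfModuli T.E) p,
      (Summit.ABC.IUTFork.DHData.ofInput T.I).logQloc p v = (Summit.ABC.IUTFork.DHData.ofInput T.I).logQloc p w
  · -- slot-constant: abc-iut-S3's pinned junction, (R4) by abc-iut-S1 — NOTHING assumed
    exact PointDict.hullEstimateOf_BIII_pinned T hP h7 (ThetaPartII.stub_R4 P hP l hl h5 hcore hP2 hP5 h6 T) hcst
  · exact hregT hcst

/-! ## §2 The θ-cut: all three binders demanded only on the content locus of the display -/

/-- **`Cor22.Thm110Legendre` (print's constants) from the weakened Corollary with slack `ε ≤ Tol(P,l)` and the cone binder, ALL THREE CUT TO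
THE CONTENT LOCUS of [IUTchIV] Thm. 1.10's display** (`6·(1 + 20·d_mod/l)·(log-diff + log-cond) + 120·d*_mod·l < log q^{∤{2,l}}(λ)`): pointwise
(`ThetaPartIIDisplay.thm110Legendre_of_pointwise`); off the locus the display is free (abc-iut-C-cert-1's `display_of_not_content`, `η > 0` from
`IsEtaPrm`); on it a genuine datum exists (abc-iut-L5-t7 `ThetaPartII.stub_thetaData`), §1 gives the hull estimate from `hregC`, the core file's
`logQAvoid_le_of_cor312Slack` the squeeze with slack and `display_of_squeezeIII_slack'` the display. `hregC` is abc-iut-C-cert-1's binder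
(`ABC_of_cor312C_of_hullRegimeC`) VERBATIM. CONDITIONAL on `h312C`, `hTolC`, `hregC`; no side taken.
[cite: Mochizuki2012, IUTchIV Thm. 1.10 pp. 22–31; Cor. 2.2 (ii) proof p. 46] [claim: Mochizuki2012, status: disputed] -/
theorem thm110Legendre_of_cor312Slack_content_hregC
    (ε : ∀ (P : NFPoint) (l : ℕ), Cor22.ThetaVolumeDatumAt P l → ℝ)
    (h312C : ∀ P : NFPoint, P ∈ UP → ∀ l : ℕ, l.Prime → 5 ≤ l →
      Cor22.AdmitsCore P → Cor22.CondP2 P l → Cor22.CondP5 P l → Cor22.CondP6 P l →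
      6 * ((1 + 20 * (Cor22.dmod P : ℝ) / l) * (P.logDiff + Cor22.logCondAvoid P {2, l}))
          + 120 * (2 ^ 12 * 3 ^ 3 * 5 * (Cor22.dmod P : ℝ) * l) < Cor22.logQAvoid P {2, l} →
      ∀ T : Cor22.ThetaVolumeDatumAt P l, T.negAbsLogQ ≤ T.negLogTheta + ε P l T)
    (hTolC : ∀ P : NFPoint, P ∈ UP → ∀ l : ℕ, l.Prime → 5 ≤ l →
      Cor22.AdmitsCore P → Cor22.CondP2 P l → Cor22.CondP5 P l → Cor22.CondP6 P l →
      6 * ((1 + 20 * (Cor22.dmod P : ℝ) / l) * (P.logDiff + Cor22.logCondAvoid P {2, l}))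
          + 120 * (2 ^ 12 * 3 ^ 3 * 5 * (Cor22.dmod P : ℝ) * l) < Cor22.logQAvoid P {2, l} →
      ∀ T : Cor22.ThetaVolumeDatumAt P l, ε P l T ≤ ((l : ℝ) + 1) / 4 * (5 * ((((2 ^ 12 * 3 ^ 3 * 5 * Cor22.dmod P : ℕ) : ℝ)) * l)))
    (hregC : ∀ P : NFPoint, P ∈ UP → ∀ l : ℕ, l.Prime → 5 ≤ l →
      Cor22.AdmitsCore P → Cor22.CondP2 P l → Cor22.CondP5 P l → Cor22.CondP6 P l →
      6 * ((1 + 20 * (Cor22.dmod P : ℝ) / l) * (P.logDiff + Cor22.logCondAvoid P {2, l}))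
          + 120 * (2 ^ 12 * 3 ^ 3 * 5 * (Cor22.dmod P : ℝ) * l) < Cor22.logQAvoid P {2, l} →
      ∀ T : Cor22.ThetaVolumeDatumAt P l,
        (letI := T.instFieldF; letI := T.instNumberFieldF; letI := T.instAlgebraF; letI := T.instFieldK
         letI := T.instNumberFieldK; letI := T.instAlgebraK; letI := T.instFieldFbar; letI := T.instAlgebraFbar
         letI := T.instAlgebraKFbar; letI := T.instIsElliptic
         ¬ (∀ p ∈ T.I.supportPrimes, ∀ v w : placesOver (fieldOfModuli T.E) p,
            (Summit.ABC.IUTFork.DHData.ofInput T.I).logQloc p v = (Summit.ABC.IUTFork.DHData.ofInput T.I).logQloc p w)) →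
        T.HullEstimateOf
          (((l : ℝ) + 1) / 4 *
            ((1 + 12 * (Cor22.dmod P : ℝ) / l) * (P.logDiff + Cor22.logCondAvoid P {2, l})
              + 2 * Real.log l + 52
              + 20 / 3 * Real.log (((2 ^ 12 * 3 ^ 3 * 5 * Cor22.dmod P : ℕ) : ℝ) * (l : ℝ))
                * (Nat.primeCounting (2 ^ 12 * 3 ^ 3 * 5 * Cor22.dmod P * l) : ℝ)))) :
    Cor22.Thm110Legendre :=
  ThetaPartIIDisplay.thm110Legendre_of_pointwise fun η hη P hP l hl h5 hne hcore hP2 hP5 h6 => by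
    by_cases hct : 6 * ((1 + 20 * (Cor22.dmod P : ℝ) / l) * (P.logDiff + Cor22.logCondAvoid P {2, l}))
          + 120 * (2 ^ 12 * 3 ^ 3 * 5 * (Cor22.dmod P : ℝ) * l) < Cor22.logQAvoid P {2, l}
    swap
    · -- OFF the content locus: the display holds by its own constant — NOTHING assumed
      exact display_of_not_content hη.1 hct
    obtain ⟨T⟩ := ThetaPartII.stub_thetaData P hP l hl h5 hcore hP2 hP5 h6
    have hgap := logQAvoid_le_of_cor312Slack T hP.1 (h312C P hP l hl h5 hcore hP2 hP5 h6 hct T)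
      (hullEstimateOf_BIII_of_offRegime hP hl h5 hcore hP2 hP5 h6 T (hregC P hP l hl h5 hcore hP2 hP5 h6 hct T))
    exact display_of_squeezeIII_slack' hl h5 hne hη (hTolC P hP l hl h5 hcore hP2 hP5 h6 hct T) hgap

/-- **`abc` FROM THE WEAKENED COROLLARY WITH A TOLERATED SLACK, θ-CUT**: [NUMΣ-C] `−|log(q)| ≤ −|log(Θ)| + ε(P,l,T)` at every genuine Θ-volume
datum of every admissible `(P, l)` ON THE CONTENT LOCUS of the display (ASSUMPTION LABEL; the weakened Corollary an `S_H|Σ`-certificate delivers,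
`ε` = the off-Σ remainder) · [TOL-C] `ε(P,l,T) ≤ ((l+1)/4)·5·d*_mod·l` there · [CONE-C] `hregC` (abc-iut-C-cert-1's binder VERBATIM) ⟹ `ABC` with NO
constant of the chain of record changed (`Cor22.exists_partII_of_thm110Legendre`, `Cor22.fullGaloisImage_holds`, route theorem `closes`,
`genEllTwo_holds`, `JInvWlog_proof` — all PROVED). At every admissible `(P, l)` with `log q^{∤{2,l}}(λ) ≤ 120·d*_mod·l` NOTHING is assumed.
CONDITIONAL; nothing is asserted about the hypotheses; no side taken. [cite: Mochizuki2012, IUTchIV Cor. 2.2–2.3 pp. 41–55]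
[cite: Mochizuki2012, IUTchIII Cor. 3.12 p. 174] [claim: Mochizuki2012, status: disputed] -/
theorem ABC_of_cor312Slack_content_hregC
    (ε : ∀ (P : NFPoint) (l : ℕ), Cor22.ThetaVolumeDatumAt P l → ℝ)
    (h312C : ∀ P : NFPoint, P ∈ UP → ∀ l : ℕ, l.Prime → 5 ≤ l →
      Cor22.AdmitsCore P → Cor22.CondP2 P l → Cor22.CondP5 P l → Cor22.CondP6 P l →
      6 * ((1 + 20 * (Cor22.dmod P : ℝ) / l) * (P.logDiff + Cor22.logCondAvoid P {2, l}))
          + 120 * (2 ^ 12 * 3 ^ 3 * 5 * (Cor22.dmod P : ℝ) * l) < Cor22.logQAvoid P {2, l} →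
      ∀ T : Cor22.ThetaVolumeDatumAt P l, T.negAbsLogQ ≤ T.negLogTheta + ε P l T)
    (hTolC : ∀ P : NFPoint, P ∈ UP → ∀ l : ℕ, l.Prime → 5 ≤ l →
      Cor22.AdmitsCore P → Cor22.CondP2 P l → Cor22.CondP5 P l → Cor22.CondP6 P l →
      6 * ((1 + 20 * (Cor22.dmod P : ℝ) / l) * (P.logDiff + Cor22.logCondAvoid P {2, l}))
          + 120 * (2 ^ 12 * 3 ^ 3 * 5 * (Cor22.dmod P : ℝ) * l) < Cor22.logQAvoid P {2, l} →
      ∀ T : Cor22.ThetaVolumeDatumAt P l, ε P l T ≤ ((l : ℝ) + 1) / 4 * (5 * ((((2 ^ 12 * 3 ^ 3 * 5 * Cor22.dmod P : ℕ) : ℝ)) * l)))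
    (hregC : ∀ P : NFPoint, P ∈ UP → ∀ l : ℕ, l.Prime → 5 ≤ l →
      Cor22.AdmitsCore P → Cor22.CondP2 P l → Cor22.CondP5 P l → Cor22.CondP6 P l →
      6 * ((1 + 20 * (Cor22.dmod P : ℝ) / l) * (P.logDiff + Cor22.logCondAvoid P {2, l}))
          + 120 * (2 ^ 12 * 3 ^ 3 * 5 * (Cor22.dmod P : ℝ) * l) < Cor22.logQAvoid P {2, l} →
      ∀ T : Cor22.ThetaVolumeDatumAt P l,
        (letI := T.instFieldF; letI := T.instNumberFieldF; letI := T.instAlgebraF; letI := T.instFieldK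
         letI := T.instNumberFieldK; letI := T.instAlgebraK; letI := T.instFieldFbar; letI := T.instAlgebraFbar
         letI := T.instAlgebraKFbar; letI := T.instIsElliptic
         ¬ (∀ p ∈ T.I.supportPrimes, ∀ v w : placesOver (fieldOfModuli T.E) p,
            (Summit.ABC.IUTFork.DHData.ofInput T.I).logQloc p v = (Summit.ABC.IUTFork.DHData.ofInput T.I).logQloc p w)) →
        T.HullEstimateOf
          (((l : ℝ) + 1) / 4 *
            ((1 + 12 * (Cor22.dmod P : ℝ) / l) * (P.logDiff + Cor22.logCondAvoid P {2, l})
              + 2 * Real.log l + 52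
              + 20 / 3 * Real.log (((2 ^ 12 * 3 ^ 3 * 5 * Cor22.dmod P : ℕ) : ℝ) * (l : ℝ))
                * (Nat.primeCounting (2 ^ 12 * 3 ^ 3 * 5 * Cor22.dmod P * l) : ℝ)))) :
    _root_.ABC := by
  refine Summit.ABC.ABC.Theses.IUTThetaPilot.closes ?_ Summit.ABC.ABC.Theorems.genEllTwo_holds Summit.ABC.ABC.Theorems.JInvWlog_proof
  unfold Summit.ABC.ABC.Theses.IUTThetaPilot.ThetaPartII
  exact Cor22.exists_partII_of_thm110Legendre (thm110Legendre_of_cor312Slack_content_hregC ε h312C hTolC hregC)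
    Cor22.fullGaloisImage_holds

/-! ## §3 The R14 recut: the binders of p469667 cut to the SZPIRO-BAD locus, `hregBad` VERBATIM from p452637 -/

/-- **`ABC_of_cor312Slack_szpiroBad_hregBad`** (rh-lead RULING R14 (3), the recut MIN-SLICE cites) — `abc` FROM THE WEAKENED COROLLARY WITH A
TOLERATED SLACK, with ALL THREE binders of p469667's `ABC_of_cor312Slack_of_hullRegime` CUT TO THE SZPIRO-BAD admissible `(P, l)`
(«`(l+5)/4 < d_mod ∨ (6l(l+5−4d_mod)/((l+4)(l−3)))·(log-diff + (1−1/l)·log-cond) + (6l(l+5)/((l+4)(l−3)))·log π < log q^{∤{2,l}}(λ)`», the antecedent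
of abc-iut-c312-d1's `Cor22.forall_cor312Of_of_szpiroBad`, inserted after (P6) exactly as in p452637): [NUMΣ-bad] `−|log(q)| ≤ −|log(Θ)| + ε(P,l,T)` at
the genuine data there · [TOL-bad] `ε(P,l,T) ≤ ((l+1)/4)·5·d*_mod·l` there · [CONE-bad] `hregBad` = abc-iut-C-cert-2's
`Conditional.abc_of_SH_orNum_K_szpiroBad_hregBad` :`hregBad` VERBATIM ⟹ `ABC`, no constant of the chain of record changed. Explicit 3 =
NUMΣ(Szpiro-bad) · TOL(Szpiro-bad) · CONE(Szpiro-bad); at every Szpiro-GOOD admissible `(P, l)` NOTHING is assumed. A λ-term over the θ-cut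
`ABC_of_cor312Slack_content_hregC` (the content guard implies the Szpiro-bad guard: abc-iut-C-cert-1's `szpiroBad_of_content`). `hregBad` is
neither proved nor refuted as typed (`Conditional.not_hreg_v4` refutes only the blanket `hreg`). CONDITIONAL; nothing is asserted about the
hypotheses; no side taken. [cite: Mochizuki2012, IUTchIV Thm. 1.10 pp. 22–31; Cor. 2.2 (ii)–(iii) pp. 43–47]
[cite: Mochizuki2012, IUTchIII Cor. 3.12 p. 174] [claim: Mochizuki2012, status: disputed] -/
theorem ABC_of_cor312Slack_szpiroBad_hregBad
    (ε : ∀ (P : NFPoint) (l : ℕ), Cor22.ThetaVolumeDatumAt P l → ℝ)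
    -- [NUMΣ, Szpiro-bad] the weakened number-level Corollary with slack `ε`, demanded ONLY at SZPIRO-BAD admissible `(P, l)`
    (h312εBad : ∀ P : NFPoint, P ∈ UP → ∀ l : ℕ, l.Prime → 5 ≤ l →
      Cor22.AdmitsCore P → Cor22.CondP2 P l → Cor22.CondP5 P l → Cor22.CondP6 P l →
      (((l : ℝ) + 5) / 4 < (Cor22.dmod P : ℝ) ∨
        6 * l * (((l : ℝ) + 5) - 4 * Cor22.dmod P) / (((l : ℝ) + 4) * ((l : ℝ) - 3))
            * (P.logDiff + (1 - 1 / (l : ℝ)) * Cor22.logCondAvoid P {2, l})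
          + 6 * l * ((l : ℝ) + 5) / (((l : ℝ) + 4) * ((l : ℝ) - 3)) * Real.log Real.pi < Cor22.logQAvoid P {2, l}) →
      ∀ T : Cor22.ThetaVolumeDatumAt P l, T.negAbsLogQ ≤ T.negLogTheta + ε P l T)
    -- [TOL, Szpiro-bad] the slack is within the tolerance of `display_of_squeezeIII_slack'`, demanded ONLY there
    (hTolBad : ∀ P : NFPoint, P ∈ UP → ∀ l : ℕ, l.Prime → 5 ≤ l →
      Cor22.AdmitsCore P → Cor22.CondP2 P l → Cor22.CondP5 P l → Cor22.CondP6 P l →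
      (((l : ℝ) + 5) / 4 < (Cor22.dmod P : ℝ) ∨
        6 * l * (((l : ℝ) + 5) - 4 * Cor22.dmod P) / (((l : ℝ) + 4) * ((l : ℝ) - 3))
            * (P.logDiff + (1 - 1 / (l : ℝ)) * Cor22.logCondAvoid P {2, l})
          + 6 * l * ((l : ℝ) + 5) / (((l : ℝ) + 4) * ((l : ℝ) - 3)) * Real.log Real.pi < Cor22.logQAvoid P {2, l}) →
      ∀ T : Cor22.ThetaVolumeDatumAt P l, ε P l T ≤ ((l : ℝ) + 1) / 4 * (5 * ((((2 ^ 12 * 3 ^ 3 * 5 * Cor22.dmod P : ℕ) : ℝ)) * l)))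
    -- [CONE, Szpiro-bad] the off-regime hull estimate with print's constant `B_III(P,l)`, demanded ONLY at SZPIRO-BAD admissible `(P, l)`
    (hregBad : ∀ P : NFPoint, P ∈ UP → ∀ l : ℕ, l.Prime → 5 ≤ l →
      Cor22.AdmitsCore P → Cor22.CondP2 P l → Cor22.CondP5 P l → Cor22.CondP6 P l →
      (((l : ℝ) + 5) / 4 < (Cor22.dmod P : ℝ) ∨
        6 * l * (((l : ℝ) + 5) - 4 * Cor22.dmod P) / (((l : ℝ) + 4) * ((l : ℝ) - 3))
            * (P.logDiff + (1 - 1 / (l : ℝ)) * Cor22.logCondAvoid P {2, l})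
          + 6 * l * ((l : ℝ) + 5) / (((l : ℝ) + 4) * ((l : ℝ) - 3)) * Real.log Real.pi < Cor22.logQAvoid P {2, l}) →
      ∀ T : Cor22.ThetaVolumeDatumAt P l,
        (letI := T.instFieldF; letI := T.instNumberFieldF; letI := T.instAlgebraF; letI := T.instFieldK
         letI := T.instNumberFieldK; letI := T.instAlgebraK; letI := T.instFieldFbar; letI := T.instAlgebraFbar
         letI := T.instAlgebraKFbar; letI := T.instIsElliptic
         ¬ (∀ p ∈ T.I.supportPrimes, ∀ v w : placesOver (fieldOfModuli T.E) p,
            (Summit.ABC.IUTFork.DHData.ofInput T.I).logQloc p v = (Summit.ABC.IUTFork.DHData.ofInput T.I).logQloc p w)) →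
        T.HullEstimateOf
          (((l : ℝ) + 1) / 4 *
            ((1 + 12 * (Cor22.dmod P : ℝ) / l) * (P.logDiff + Cor22.logCondAvoid P {2, l})
              + 2 * Real.log l + 52
              + 20 / 3 * Real.log (((2 ^ 12 * 3 ^ 3 * 5 * Cor22.dmod P : ℕ) : ℝ) * (l : ℝ))
                * (Nat.primeCounting (2 ^ 12 * 3 ^ 3 * 5 * Cor22.dmod P * l) : ℝ))))
    : _root_.ABC :=
  ABC_of_cor312Slack_content_hregC ε
    (fun P hP l hl h5 hcore hP2 hP5 h6 hct => h312εBad P hP l hl h5 hcore hP2 hP5 h6 (szpiroBad_of_content h5 hct))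
    (fun P hP l hl h5 hcore hP2 hP5 h6 hct => hTolBad P hP l hl h5 hcore hP2 hP5 h6 (szpiroBad_of_content h5 hct))
    (fun P hP l hl h5 hcore hP2 hP5 h6 hct => hregBad P hP l hl h5 hcore hP2 hP5 h6 (szpiroBad_of_content h5 hct))

/-- **`ABC_of_cor312Slack_hregBad`** — THE MINIMAL RECUT (guard-only delta): p469667's `ABC_of_cor312Slack_of_hullRegime` with its [NUMΣ] `h312ε`
and [TOL] `hTol` binders AS THEY WERE (at every admissible `(P, l)`) and ONLY the cone binder replaced, `hreg ↦ hregBad` (p452637 VERBATIM).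
Premise drop over `ABC_of_cor312Slack_szpiroBad_hregBad`. CONDITIONAL; nothing is asserted about the hypotheses; no side taken.
[cite: Mochizuki2012, IUTchIV Cor. 2.2–2.3 pp. 41–55] [cite: Mochizuki2012, IUTchIII Cor. 3.12 p. 174] [claim: Mochizuki2012, status: disputed] -/
theorem ABC_of_cor312Slack_hregBad
    (ε : ∀ (P : NFPoint) (l : ℕ), Cor22.ThetaVolumeDatumAt P l → ℝ)
    (h312ε : ∀ P : NFPoint, P ∈ UP → ∀ l : ℕ, l.Prime → 5 ≤ l →
      Cor22.AdmitsCore P → Cor22.CondP2 P l → Cor22.CondP5 P l → Cor22.CondP6 P l →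
      ∀ T : Cor22.ThetaVolumeDatumAt P l, T.negAbsLogQ ≤ T.negLogTheta + ε P l T)
    (hTol : ∀ P : NFPoint, P ∈ UP → ∀ l : ℕ, l.Prime → 5 ≤ l →
      Cor22.AdmitsCore P → Cor22.CondP2 P l → Cor22.CondP5 P l → Cor22.CondP6 P l →
      ∀ T : Cor22.ThetaVolumeDatumAt P l, ε P l T ≤ ((l : ℝ) + 1) / 4 * (5 * ((((2 ^ 12 * 3 ^ 3 * 5 * Cor22.dmod P : ℕ) : ℝ)) * l)))
    (hregBad : ∀ P : NFPoint, P ∈ UP → ∀ l : ℕ, l.Prime → 5 ≤ l →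
      Cor22.AdmitsCore P → Cor22.CondP2 P l → Cor22.CondP5 P l → Cor22.CondP6 P l →
      (((l : ℝ) + 5) / 4 < (Cor22.dmod P : ℝ) ∨
        6 * l * (((l : ℝ) + 5) - 4 * Cor22.dmod P) / (((l : ℝ) + 4) * ((l : ℝ) - 3))
            * (P.logDiff + (1 - 1 / (l : ℝ)) * Cor22.logCondAvoid P {2, l})
          + 6 * l * ((l : ℝ) + 5) / (((l : ℝ) + 4) * ((l : ℝ) - 3)) * Real.log Real.pi < Cor22.logQAvoid P {2, l}) →
      ∀ T : Cor22.ThetaVolumeDatumAt P l,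
        (letI := T.instFieldF; letI := T.instNumberFieldF; letI := T.instAlgebraF; letI := T.instFieldK
         letI := T.instNumberFieldK; letI := T.instAlgebraK; letI := T.instFieldFbar; letI := T.instAlgebraFbar
         letI := T.instAlgebraKFbar; letI := T.instIsElliptic
         ¬ (∀ p ∈ T.I.supportPrimes, ∀ v w : placesOver (fieldOfModuli T.E) p,
            (Summit.ABC.IUTFork.DHData.ofInput T.I).logQloc p v = (Summit.ABC.IUTFork.DHData.ofInput T.I).logQloc p w)) →
        T.HullEstimateOf
          (((l : ℝ) + 1) / 4 *
            ((1 + 12 * (Cor22.dmod P : ℝ) / l) * (P.logDiff + Cor22.logCondAvoid P {2, l})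
              + 2 * Real.log l + 52
              + 20 / 3 * Real.log (((2 ^ 12 * 3 ^ 3 * 5 * Cor22.dmod P : ℕ) : ℝ) * (l : ℝ))
                * (Nat.primeCounting (2 ^ 12 * 3 ^ 3 * 5 * Cor22.dmod P * l) : ℝ))))
    : _root_.ABC :=
  ABC_of_cor312Slack_szpiroBad_hregBad ε (fun P hP l hl h5 hcore hP2 hP5 h6 _ => h312ε P hP l hl h5 hcore hP2 hP5 h6)
    (fun P hP l hl h5 hcore hP2 hP5 h6 _ => hTol P hP l hl h5 hcore hP2 hP5 h6) hregBad

end Summit.ABC.IUTFork.Conditional.Cor312Slack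

end
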